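import Mathlib.NumberTheory.Real.Irrational
import Mathlib.Tactic
import HarnessLib

/-!
# Dyadic `GapP`-style approximation of `(2A + √2·B)/2^{h+1}` with EXACT thresholds `2/3`, `1/3`

Topic `Literature/Computability/QuantumComplexity`. Service file (theorems only, no named facts)
for the discharge of the named fact `BQPRel_subset_AWPPRel` (`CountingSimulationRel.lean`:
Fortnow–Rogers 1999, Thm. 3.1 relativized, `BQP^A ⊆ AWPP^A`) and of `BQP_subset_AWPP`
(`CountingSimulation.lean`) in the tree's models, where

* the acceptance probability of a Clifford+`T` circuit with oracle gates is a set weight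
  `W(S) = (A_S + (√2/2)·B_S)/2^h = (2A_S + √2·B_S)/2^{h+1}` with INTEGER pair counts `A_S`, `B_S`
  (`Literature.Computability.QuantumComplexity.two_pow_mul_annWeight`, `OraclePathSums.lean`;
  Adleman–DeMarrais–Huang 1997, Lemma 6.10), and
* `AWPP^O` is Fenner's `GapP` form with a dyadic denominator and the SAME constants as `BQP^O`:
  `x ∈ L → 2/3 ≤ g(x)/2^p ≤ 1`, `x ∉ L → 0 ≤ g(x)/2^p ≤ 1/3` (`mem_AWPPRel_iff`).

Fortnow–Rogers prove Thm. 3.1 from the Bernstein–Vazirani normal form with rational amplitudes,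
so that the acceptance probability is itself a `GapP` quotient; for Clifford+`T` the probability
`(2A + √2 B)/2^{h+1}` is irrational whenever `B ≠ 0`, and the integer-valued candidate is the
dyadic approximation `g = 2^{k+1} A + ⌊2^k √2⌋ B` over `2^{h+1+k}`. This file proves that the
approximation respects the exact thresholds, with no error reduction, because `√2` is badly
approximable:

* `one_div_le_abs_sqrt_two_sub_div` — `1/(4q²) ≤ |√2 − p/q|` (Liouville's inequality for `√2`);
* `sqrtTwoFloor k = ⌊2^k √2⌋` (as `Nat.sqrt (2·4^k)`) with `sqrtTwoFloor_le`, `lt_sqrtTwoFloor_add_one`;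
* `sqrtTwoForm A B h = (2A + √2 B)/2^{h+1}`, `dyadicGap A B k = 2^{k+1} A + ⌊2^k√2⌋ B` and the error
  bound `abs_dyadicGap_div_sub_sqrtTwoForm_le` (`≤ |B|/2^{k+h+1}`);
* `le_abs_sqrtTwoForm_sub_div` — for `B ≠ 0` the form keeps distance `≥ 1/(v²|B|2^{h+3})` from
  every rational `u/v`;
* **`awppBounds_of_sqrtTwoForm`** — if `|B| ≤ 2^M`, `2M + 6 ≤ k` and `0 ≤ (2A + √2B)/2^{h+1} ≤ 1`, then
  `2/3 ≤ (2A + √2B)/2^{h+1} → 2·2^{h+1+k} ≤ 3g ∧ g ≤ 2^{h+1+k}` and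
  `(2A + √2B)/2^{h+1} ≤ 1/3 → 0 ≤ g ∧ 3g ≤ 2^{h+1+k}` — literally the two clauses of `mem_AWPPRel_iff`
  for the two clauses of `BQPRel`.

## References

* L. Fortnow, J. Rogers, *Complexity limitations on quantum computation*, JCSS 59 (1999)
  (arXiv:cs/9811023), Thm. 3.1 and Lemma 3.2 (acceptance probability as a `GapP` quotient)
  [FortnowRogers1999JCSS].
* L. M. Adleman, J. DeMarrais, M.-D. A. Huang, *Quantum computability*, SIAM J. Comput. 26 (1997),
  §6, Lemma 6.10 (pairs of paths) [AdlemanDeMarraisHuang1997].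
* S. Fenner, *PP-lowness and a simple definition of AWPP*, Theory Comput. Syst. 36 (2003), Thm. 1.2
  (the dyadic constant-error form of `AWPP`) [Fenner2003].
* J. Liouville (1844) / Hardy–Wright, *An Introduction to the Theory of Numbers*, Thm. 191
  (`|√2 − p/q| > 1/(4q²)`-type bounds for quadratic irrationals) [folklore].
-/

noncomputable section

namespace Literature.Computability.QuantumComplexity

namespace SqrtTwoDyadic

open Real

/-! ### `√2` is badly approximable -/

/-- `2q² ≠ p²` for `q ≠ 0` (irrationality of `√2`). [folklore] -/
theorem two_mul_sq_ne_sq (p q : ℤ) (hq : q ≠ 0) : 2 * q ^ 2 - p ^ 2 ≠ 0 := by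
  intro h0
  have hq' : (q : ℝ) ≠ 0 := by exact_mod_cast hq
  have h1 : ((p : ℝ) / q) ^ 2 = 2 := by
    have : (2 : ℝ) * (q : ℝ) ^ 2 - (p : ℝ) ^ 2 = 0 := by exact_mod_cast h0
    field_simp
    linarith
  have h2 : Real.sqrt 2 = |(p : ℝ) / q| := by
    rw [← h1, Real.sqrt_sq_eq_abs]
  have h3 : Real.sqrt 2 = ((|p| : ℤ) : ℝ) / ((|q| : ℤ) : ℝ) := by
    rw [h2, abs_div, Int.cast_abs, Int.cast_abs]
  exact (irrational_iff_ne_rational _).1 irrational_sqrt_two |p| |q| (abs_ne_zero.2 hq) h3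

/-- **Liouville's inequality for `√2`**: `1/(4q²) ≤ |√2 − p/q|` for all integers `p`, `q ≠ 0`.
[folklore] -/
theorem one_div_le_abs_sqrt_two_sub_div (p q : ℤ) (hq : q ≠ 0) :
    1 / (4 * (q : ℝ) ^ 2) ≤ |Real.sqrt 2 - p / q| := by
  have hq' : (q : ℝ) ≠ 0 := by exact_mod_cast hq
  have hq2 : (1 : ℝ) ≤ (q : ℝ) ^ 2 := by
    have : (1 : ℤ) ≤ q ^ 2 := by
      have h := Int.one_le_abs hq
      nlinarith [abs_mul_abs_self q, abs_nonneg q]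
    exact_mod_cast this
  set s := Real.sqrt 2 with hs
  have hs0 : 0 ≤ s := Real.sqrt_nonneg 2
  have hs2 : s ^ 2 = 2 := Real.sq_sqrt (by norm_num)
  have hs15 : s < 3 / 2 := by nlinarith
  have hs14 : 7 / 5 < s := by nlinarith
  set t : ℝ := (p : ℝ) / q with ht
  by_cases h1 : 1 ≤ |s - t|
  · calc 1 / (4 * (q : ℝ) ^ 2) ≤ 1 / 4 := by
          rw [div_le_div_iff₀ (by positivity) (by norm_num)]
          linarith
      _ ≤ |s - t| := by linarith
  · push Not at h1
    have hlt := abs_lt.1 h1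
    -- `|2 - t²| ≥ 1/q²`
    have hge : 1 / (q : ℝ) ^ 2 ≤ |2 - t ^ 2| := by
      have hz : (1 : ℝ) ≤ |((2 * q ^ 2 - p ^ 2 : ℤ) : ℝ)| := by
        exact_mod_cast Int.one_le_abs (two_mul_sq_ne_sq p q hq)
      have e : (2 : ℝ) - t ^ 2 = ((2 * q ^ 2 - p ^ 2 : ℤ) : ℝ) / (q : ℝ) ^ 2 := by
        push_cast
        rw [ht]
        field_simp
      rw [e, abs_div, abs_of_pos (by positivity : (0 : ℝ) < (q : ℝ) ^ 2)]
      exact div_le_div_of_nonneg_right hz (by positivity)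
    have e2 : (2 : ℝ) - t ^ 2 = (s - t) * (s + t) := by linear_combination (-1 : ℝ) * hs2
    have habs : |s + t| < 4 := by
      rw [abs_lt]
      constructor <;> linarith
    have hd0 : 0 < |s - t| := by
      rcases eq_or_ne (s - t) 0 with h0 | h0
      · exfalso
        have : (2 : ℝ) - t ^ 2 = 0 := by rw [e2, h0, zero_mul]
        rw [this, abs_zero] at hge
        have : (0 : ℝ) < 1 / (q : ℝ) ^ 2 := by positivity
        linarith
      · exact abs_pos.2 h0
    have key : 1 / (q : ℝ) ^ 2 < 4 * |s - t| := by
      calc 1 / (q : ℝ) ^ 2 ≤ |2 - t ^ 2| := hge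
        _ = |s - t| * |s + t| := by rw [e2, abs_mul]
        _ < |s - t| * 4 := mul_lt_mul_of_pos_left habs hd0
        _ = 4 * |s - t| := by ring
    have : 1 / (4 * (q : ℝ) ^ 2) = (1 / (q : ℝ) ^ 2) / 4 := by
      field_simp
    rw [this]
    linarith

/-- From Liouville's inequality: `1/(4|q|) ≤ |√2·q − p|` for `q ≠ 0`. [folklore] -/
theorem one_div_le_abs_sqrt_two_mul_sub (p q : ℤ) (hq : q ≠ 0) :
    1 / (4 * |(q : ℝ)|) ≤ |Real.sqrt 2 * q - p| := by
  have hq' : (q : ℝ) ≠ 0 := by exact_mod_cast hq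
  have hqa : 0 < |(q : ℝ)| := abs_pos.2 hq'
  have h := one_div_le_abs_sqrt_two_sub_div p q hq
  have e : |Real.sqrt 2 * q - p| = |Real.sqrt 2 - p / q| * |(q : ℝ)| := by
    rw [← abs_mul]
    congr 1
    field_simp
  rw [e]
  have e2 : 1 / (4 * |(q : ℝ)|) = 1 / (4 * (q : ℝ) ^ 2) * |(q : ℝ)| := by
    rw [← sq_abs (q : ℝ)]
    field_simp
  rw [e2]
  exact mul_le_mul_of_nonneg_right h hqa.le

/-! ### The dyadic floor of `2^k √2` -/

/-- `sqrtTwoFloor k = ⌊2^k √2⌋ = ⌊√(2·4^k)⌋`, a natural number computable by integer square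
root (this is how a counting machine hard-wires the constant). [folklore] -/
def sqrtTwoFloor (k : ℕ) : ℕ := Nat.sqrt (2 * 4 ^ k)

/-- `(2^k)² = 4^k` in `ℝ`. [folklore] -/
theorem two_pow_sq (k : ℕ) : ((2 : ℝ) ^ k) ^ 2 = (4 : ℝ) ^ k := by
  rw [← pow_mul, mul_comm, pow_mul]
  norm_num

/-- `⌊2^k √2⌋ ≤ 2^k √2`. [folklore] -/
theorem sqrtTwoFloor_le (k : ℕ) : (sqrtTwoFloor k : ℝ) ≤ 2 ^ k * Real.sqrt 2 := by
  have h1 : (sqrtTwoFloor k) ^ 2 ≤ 2 * 4 ^ k := Nat.sqrt_le' _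
  have h1' : ((sqrtTwoFloor k : ℝ)) ^ 2 ≤ (2 ^ k * Real.sqrt 2) ^ 2 := by
    rw [mul_pow, Real.sq_sqrt (by norm_num : (0 : ℝ) ≤ 2), two_pow_sq]
    have : ((sqrtTwoFloor k : ℝ)) ^ 2 ≤ 2 * 4 ^ k := by exact_mod_cast h1
    linarith
  exact (sq_le_sq₀ (by positivity) (by positivity)).1 h1'

/-- `2^k √2 < ⌊2^k √2⌋ + 1`. [folklore] -/
theorem lt_sqrtTwoFloor_add_one (k : ℕ) : 2 ^ k * Real.sqrt 2 < sqrtTwoFloor k + 1 := by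
  have h1 : 2 * 4 ^ k < (sqrtTwoFloor k + 1) ^ 2 := Nat.lt_succ_sqrt' _
  have h1' : (2 ^ k * Real.sqrt 2) ^ 2 < ((sqrtTwoFloor k : ℝ) + 1) ^ 2 := by
    rw [mul_pow, Real.sq_sqrt (by norm_num : (0 : ℝ) ≤ 2), two_pow_sq]
    have : (2 * 4 ^ k : ℝ) < ((sqrtTwoFloor k : ℝ) + 1) ^ 2 := by exact_mod_cast h1
    linarith
  exact (sq_lt_sq₀ (by positivity) (by positivity)).1 h1'

/-- `|⌊2^k √2⌋ − 2^k √2| ≤ 1`. [folklore] -/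
theorem abs_sqrtTwoFloor_sub_le (k : ℕ) : |(sqrtTwoFloor k : ℝ) - 2 ^ k * Real.sqrt 2| ≤ 1 := by
  rw [abs_le]
  constructor <;> linarith [sqrtTwoFloor_le k, lt_sqrtTwoFloor_add_one k]

/-! ### The form `(2A + √2 B)/2^{h+1}` and its dyadic `GapP` numerator -/

/-- `sqrtTwoForm A B h = (2A + √2·B)/2^{h+1}` — the shape of a Clifford+`T` set weight with pair
counts `A`, `B` and `h` Hadamard gates (`two_pow_mul_annWeight`). [cite: AdlemanDeMarraisHuang1997, §6 Lemma 6.10] -/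
def sqrtTwoForm (A B : ℤ) (h : ℕ) : ℝ := (2 * A + Real.sqrt 2 * B) / 2 ^ (h + 1)

/-- `dyadicGap A B k = 2^{k+1}·A + ⌊2^k√2⌋·B` — the integer numerator approximating
`2^{h+1+k} · sqrtTwoForm A B h` (a `ℤ`-linear combination of the pair counts with nonnegative,
polynomial-time computable coefficients, hence a `GapP` function of the input when `A`, `B` are).
[cite: FortnowRogers1999JCSS, Lemma 3.2 (arXiv numbering)] -/
def dyadicGap (A B : ℤ) (k : ℕ) : ℤ := 2 ^ (k + 1) * A + (sqrtTwoFloor k : ℤ) * B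

/-- The approximation error, exactly. [folklore] -/
theorem dyadicGap_div_sub_sqrtTwoForm (A B : ℤ) (h k : ℕ) :
    (dyadicGap A B k : ℝ) / 2 ^ (h + 1 + k) - sqrtTwoForm A B h =
      (B : ℝ) * ((sqrtTwoFloor k : ℝ) - 2 ^ k * Real.sqrt 2) / (2 ^ k * 2 ^ (h + 1)) := by
  unfold dyadicGap sqrtTwoForm
  push_cast
  field_simp
  ring

/-- **Error bound**: `|dyadicGap/2^{h+1+k} − sqrtTwoForm| ≤ |B|/(2^k·2^{h+1})`. [folklore] -/
theorem abs_dyadicGap_div_sub_sqrtTwoForm_le (A B : ℤ) (h k : ℕ) :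
    |(dyadicGap A B k : ℝ) / 2 ^ (h + 1 + k) - sqrtTwoForm A B h| ≤
      |(B : ℝ)| / (2 ^ k * 2 ^ (h + 1)) := by
  rw [dyadicGap_div_sub_sqrtTwoForm, abs_div, abs_mul,
    abs_of_pos (by positivity : (0 : ℝ) < 2 ^ k * 2 ^ (h + 1))]
  apply div_le_div_of_nonneg_right _ (by positivity)
  calc |(B : ℝ)| * |(sqrtTwoFloor k : ℝ) - 2 ^ k * Real.sqrt 2| ≤ |(B : ℝ)| * 1 :=
        mul_le_mul_of_nonneg_left (abs_sqrtTwoFloor_sub_le k) (abs_nonneg _)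
    _ = |(B : ℝ)| := mul_one _

/-- When `B = 0` the dyadic numerator is exact. [folklore] -/
theorem dyadicGap_div_eq_of_zero (A : ℤ) (h k : ℕ) :
    (dyadicGap A 0 k : ℝ) / 2 ^ (h + 1 + k) = sqrtTwoForm A 0 h := by
  have := dyadicGap_div_sub_sqrtTwoForm A 0 h k
  simp only [Int.cast_zero, zero_mul, zero_div] at this
  linarith

/-- **Margin**: for `B ≠ 0` the form `(2A + √2B)/2^{h+1}` keeps distance at least
`1/(v²·|B|·2^{h+3})` from every rational `u/v` (`v > 0`). [folklore] -/
theorem le_abs_sqrtTwoForm_sub_div (A B : ℤ) (hB : B ≠ 0) (h : ℕ) (u : ℤ) (v : ℕ) (hv : 0 < v) :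
    1 / ((v : ℝ) ^ 2 * |(B : ℝ)| * 2 ^ (h + 3)) ≤ |sqrtTwoForm A B h - u / v| := by
  have hv' : (0 : ℝ) < v := by exact_mod_cast hv
  have hBr : (B : ℝ) ≠ 0 := by exact_mod_cast hB
  have hBa : |(B : ℝ)| ≠ 0 := abs_ne_zero.2 hBr
  have e : sqrtTwoForm A B h - u / v =
      (Real.sqrt 2 * (((v : ℤ) * B : ℤ) : ℝ) - ((u * 2 ^ (h + 1) - 2 * (v : ℤ) * A : ℤ) : ℝ)) /
        ((v : ℝ) * 2 ^ (h + 1)) := by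
    unfold sqrtTwoForm
    push_cast
    field_simp
    ring
  have hq : ((v : ℤ) * B) ≠ 0 := mul_ne_zero (by exact_mod_cast hv.ne') hB
  have key := one_div_le_abs_sqrt_two_mul_sub (u * 2 ^ (h + 1) - 2 * (v : ℤ) * A) ((v : ℤ) * B) hq
  rw [e, abs_div, abs_of_pos (by positivity : (0 : ℝ) < v * 2 ^ (h + 1)),
    le_div_iff₀ (by positivity : (0 : ℝ) < v * 2 ^ (h + 1))]
  refine le_trans (le_of_eq ?_) key
  push_cast
  rw [abs_mul, abs_of_pos hv']
  field_simp
  ring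

/-! ### The exact thresholds -/

/-- **The dyadic numerator respects the exact thresholds `2/3`, `1/3` (and `0`, `1`).** If
`|B| ≤ 2^M`, `2M + 6 ≤ k` and `0 ≤ (2A + √2B)/2^{h+1} ≤ 1`, then with `g = dyadicGap A B k` and
`p = h + 1 + k`:
`2/3 ≤ (2A + √2B)/2^{h+1} → 2·2^p ≤ 3g ∧ g ≤ 2^p` and `(2A + √2B)/2^{h+1} ≤ 1/3 → 0 ≤ g ∧ 3g ≤ 2^p`.
Proof: for `B = 0` the quotient `g/2^p` is the form itself; for `B ≠ 0` the form is at distance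
`≥ 1/(9|B|2^{h+3})` from `0, 1/3, 2/3, 1` (`le_abs_sqrtTwoForm_sub_div`) while the approximation
error is `≤ |B|/2^{k+h+1} < 1/(9|B|2^{h+3})`. [cite: FortnowRogers1999JCSS, Thm. 3.1 and Lemma 3.2 (arXiv numbering)] [cite: Fenner2003, Thm. 1.2] -/
theorem awppBounds_of_sqrtTwoForm (A B : ℤ) (h k M : ℕ) (hBM : |B| ≤ 2 ^ M) (hk : 2 * M + 6 ≤ k)
    (h0 : 0 ≤ sqrtTwoForm A B h) (h1 : sqrtTwoForm A B h ≤ 1) :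
    (2 / 3 ≤ sqrtTwoForm A B h →
        2 * (2 : ℤ) ^ (h + 1 + k) ≤ 3 * dyadicGap A B k ∧ dyadicGap A B k ≤ (2 : ℤ) ^ (h + 1 + k)) ∧
    (sqrtTwoForm A B h ≤ 1 / 3 →
        0 ≤ dyadicGap A B k ∧ 3 * dyadicGap A B k ≤ (2 : ℤ) ^ (h + 1 + k)) := by
  set Pr := sqrtTwoForm A B h with hPr
  set g := dyadicGap A B k with hg
  have hP : (0 : ℝ) < 2 ^ (h + 1 + k) := by positivity
  have cast1 : ∀ {a b : ℤ}, ((a : ℝ) ≤ b) → a ≤ b := fun h => by exact_mod_cast h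
  by_cases hB : B = 0
  · -- the dyadic numerator is exact
    have hgPr : (g : ℝ) = 2 ^ (h + 1 + k) * Pr := by
      have e := dyadicGap_div_eq_of_zero A h k
      rw [← hB] at e
      rw [hg, hPr, ← e]
      field_simp
    refine ⟨fun h23 => ⟨cast1 ?_, cast1 ?_⟩, fun h13 => ⟨cast1 ?_, cast1 ?_⟩⟩ <;> push_cast <;>
      rw [hgPr] <;> nlinarith
  · have herr := abs_dyadicGap_div_sub_sqrtTwoForm_le A B h k
    have hBM' : |(B : ℝ)| ≤ 2 ^ M := by
      rw [← Int.cast_abs]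
      exact_mod_cast hBM
    have hBpos : 0 < |(B : ℝ)| := abs_pos.2 (by exact_mod_cast hB)
    -- the common margin `μ = 1/(9|B|2^{h+3})` at the four rationals `0, 1/3, 2/3, 1`
    set μ : ℝ := 1 / (9 * |(B : ℝ)| * 2 ^ (h + 3)) with hμ
    have hμv : ∀ (v : ℕ), 0 < v → v ≤ 3 → μ ≤ 1 / ((v : ℝ) ^ 2 * |(B : ℝ)| * 2 ^ (h + 3)) := by
      intro v hv hv3
      apply one_div_le_one_div_of_le (by positivity)
      have hv3' : (v : ℝ) ≤ 3 := by exact_mod_cast hv3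
      have hv0 : (0 : ℝ) ≤ v := by positivity
      have : (v : ℝ) ^ 2 ≤ 9 := by nlinarith
      have h23 : (0 : ℝ) < 2 ^ (h + 3) := by positivity
      nlinarith [mul_pos hBpos h23]
    have m0 : μ ≤ |Pr - 0| := by
      simpa using (hμv 1 one_pos (by norm_num)).trans (le_abs_sqrtTwoForm_sub_div A B hB h 0 1 one_pos)
    have m1 : μ ≤ |Pr - 1| := by
      simpa using (hμv 1 one_pos (by norm_num)).trans (le_abs_sqrtTwoForm_sub_div A B hB h 1 1 one_pos)
    have m13 : μ ≤ |Pr - 1 / 3| := by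
      simpa using (hμv 3 (by norm_num) le_rfl).trans (le_abs_sqrtTwoForm_sub_div A B hB h 1 3 (by norm_num))
    have m23 : μ ≤ |Pr - 2 / 3| := by
      simpa using (hμv 3 (by norm_num) le_rfl).trans (le_abs_sqrtTwoForm_sub_div A B hB h 2 3 (by norm_num))
    -- the error is smaller than the margin
    have hk' : (9 : ℝ) * 2 ^ (2 * M + 2) < 2 ^ k := by
      calc (9 : ℝ) * 2 ^ (2 * M + 2) < 16 * 2 ^ (2 * M + 2) :=
            mul_lt_mul_of_pos_right (by norm_num) (by positivity)
        _ = 2 ^ (2 * M + 6) := by rw [show (16 : ℝ) = 2 ^ 4 by norm_num, ← pow_add]; ring_nf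
        _ ≤ 2 ^ k := pow_le_pow_right₀ (by norm_num) hk
    have hEμ : |(B : ℝ)| / (2 ^ k * 2 ^ (h + 1)) < μ := by
      rw [hμ, div_lt_div_iff₀ (by positivity) (by positivity), one_mul]
      have h21 : (0 : ℝ) < 2 ^ (h + 1) := by positivity
      calc |(B : ℝ)| * (9 * |(B : ℝ)| * 2 ^ (h + 3)) ≤ 2 ^ M * (9 * 2 ^ M * 2 ^ (h + 3)) := by gcongr
        _ = 9 * 2 ^ (2 * M + 2) * 2 ^ (h + 1) := by ring
        _ < 2 ^ k * 2 ^ (h + 1) := mul_lt_mul_of_pos_right hk' h21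
    obtain ⟨hl, hr⟩ := abs_lt.1 (herr.trans_lt hEμ)
    refine ⟨fun h23 => ⟨cast1 ?_, cast1 ?_⟩, fun h13 => ⟨cast1 ?_, cast1 ?_⟩⟩
    · -- `2/3 ≤ Pr`, so `Pr ≥ 2/3 + μ`, so `g/2^p > 2/3`
      rw [abs_of_nonneg (by linarith)] at m23
      have : (2 : ℝ) / 3 < (g : ℝ) / 2 ^ (h + 1 + k) := by linarith
      rw [lt_div_iff₀ hP] at this
      push_cast
      linarith
    · -- `Pr ≤ 1`, so `Pr ≤ 1 - μ`, so `g/2^p < 1`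
      rw [abs_of_nonpos (by linarith)] at m1
      have : (g : ℝ) / 2 ^ (h + 1 + k) < 1 := by linarith
      rw [div_lt_iff₀ hP] at this
      push_cast
      linarith
    · -- `0 ≤ Pr`, so `μ ≤ Pr`, so `0 < g/2^p`
      rw [abs_of_nonneg (by linarith)] at m0
      have : (0 : ℝ) < (g : ℝ) / 2 ^ (h + 1 + k) := by linarith
      rw [lt_div_iff₀ hP] at this
      push_cast
      linarith
    · -- `Pr ≤ 1/3`, so `Pr ≤ 1/3 - μ`, so `g/2^p < 1/3`
      rw [abs_of_nonpos (by linarith)] at m13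
      have : (g : ℝ) / 2 ^ (h + 1 + k) < 1 / 3 := by linarith
      rw [div_lt_iff₀ hP] at this
      push_cast
      linarith

end SqrtTwoDyadic

end Literature.Computability.QuantumComplexity

end
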